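import Mathlib.Topology.MetricSpace.Contracting
import Literature.Barriers.CriticalPhenomena.WeaklySAWFlowMap
import HarnessLib

/-!
# [BBS-rg-flow, Theorem 1.4(i)] by Banach's fixed point theorem: the flow of `Φ = (ψ, φ̄ + ρ)` with
# the boundary conditions `(K₀, g₀)`, `(z_∞, μ_∞) = (0,0)` and the bounds (1.11)–(1.14)

Twelfth file of the series formalising [BBS-rg-flow] (Bauerschmidt–Brydges–Slade, AHP 16 (2015),
arXiv:1211.2477), the abstract dynamical-system input of BBS 2015, Theorem 4.1 (via its Theorem 7.2.1),
towards `Literature.Barriers.CriticalPhenomena.WeaklySAWFourDimLogCorrections`; continuation of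
`WeaklySAWFlowMap.lean` (the flow map `T` in scaled coordinates and its pointwise Lipschitz estimates).

As explained in `WeaklySAWFlowMap.lean`, we replace the continuity-method ODE of §3.1 of the source
by Banach's fixed point theorem for `T` on the closed ball
`s = {‖K̃‖_∞ ≤ b, ‖Ṽ‖_∞ ≤ b} ⊂ ℓ^∞(∏𝒲_j) × ℓ^∞(ℝ³)` (= `x̄ + b𝔹` of §3.2 = the bounds (1.11)–(1.14)).
This file proves:
* sequence-level Lipschitz and size bounds of `T^K` and `Ñ` on `s` (`norm_TK_sub_le`, `norm_srcN_sub_le`,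
  `norm_TK_le`, `norm_srcN_le`; constants `lipK = κϑ + 4Mε₁𝗁/(a-a_*)`,
  `lipN = M(a-a_*)ϑ/𝗁 + 8(2B+14C)Ωε₂𝗁b + 4Mε₁`), under the standing data `BallHyp` (`𝗁 > 0`,
  `b ∈ (0,1]`, `0 ≤ a_* < a`, Lemma 1.3 for `K̄`, `4g₀ ≤ e⁻¹`, `2g₀ ≤ e⁻²`);
* `T` maps `s` into itself and is `θ`-Lipschitz on `s` under the smallness conditions `SmallHyp`
  (`lipK ≤ θ`, `‖S‖lipN ≤ θ`, `‖S‖M/𝗁 + θb ≤ b`, `θ < 1` — these are what `𝗁 ≥ 𝗁_*` and `g₀ ≤ g_*`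
  buy in Theorem 1.4), hence has a UNIQUE fixed point in `s` (`exists_fixedPoint_Tmap`,
  `fixedPoint_unique`; `ContractingWith.exists_fixedPoint'` on the complete set `s`);
* the fixed point IS the flow: its physical sequence `x_j = x̄_j + (𝗐_KK̃_j, 𝗐_V·Ṽ_j)` satisfies
  `K_{j+1} = ψ_j(x_j)` (`physSeq_K_of_fixedPoint`), `V_{j+1} = φ̄_j(V_j) + ρ_j(x_j)` with `g₀` prescribed
  and `(z_j, μ_j) → 0` (`physSeq_V_of_fixedPoint`, through `sbarVP_solves`, `dmap_flow_apply` and the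
  exact quadratic remainder), lies in `∏_j D_j` and obeys (1.11)–(1.14) (`flowBounds_physSeq`);
* **Theorem 1.4(i), existence with bounds, conditional form** (`exists_perturbedFlow`): under
  `CutoffQuadHyp` (= (A1)–(A2) at `g₀`), (A3) along `x̄`, `BallHyp` and `SmallHyp` there is a global
  flow of `Φ` with the boundary conditions and the bounds (1.11)–(1.14).

Deliberately NOT here (next files): the thresholds `𝗁_*`, `g_*` discharging `BallHyp`/`SmallHyp`
from (A1)–(A3) alone, the uniqueness clause among all flows with the bounds, the neighbourhood `𝓘`
and part (ii) (regularity in `(K₀, g₀)`).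

## References
* R. Bauerschmidt, D. C. Brydges, G. Slade, *Structural stability of a dynamical system near a
  non-hyperbolic fixed point*, Ann. Henri Poincaré 16 (2015), arXiv:1211.2477: Theorem 1.4(i),
  (1.4)–(1.5), (1.11)–(1.14), §3.1–§3.2, Lemma 3.3. [BauerschmidtBrydgesSlade2015Flow]
* R. Bauerschmidt, D. C. Brydges, G. Slade, CMP 338 (2015), Theorem 7.2.1(i). [BauerschmidtBrydgesSlade2015LogCorr]
-/

noncomputable section

open Filter Topology Set
open scoped BigOperators ENNReal NNReal

namespace Literature.Barriers.CriticalPhenomena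

namespace CTWSAW

/-! ## The contraction: sequence-level bounds for `T`, the ball `s`, and the fixed point -/

open scoped ENNReal NNReal

section ContractionDefs

variable {W : ℕ → Type*} [∀ j, NormedAddCommGroup (W j)] [∀ j, NormedSpace ℝ (W j)]

/-- The closed `b`-ball of `X^𝗐` in scaled coordinates: `‖K̃‖_∞ ≤ b`, `‖Ṽ‖_∞ ≤ b` — the set
`x̄ + b𝔹` of §3.2, i.e. exactly the bounds (1.11)–(1.14). [cite: BauerschmidtBrydgesSlade2015Flow, §3.2 ("x ∈ x̄ + b𝔹")] -/
def scaledBall (W : ℕ → Type*) [∀ j, NormedAddCommGroup (W j)] (b : ℝ) : Set (SeqK W × SeqV) :=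
  {y | ‖y.1‖ ≤ b ∧ ‖y.2‖ ≤ b}

omit [∀ j, NormedSpace ℝ (W j)] in
/-- Membership in the ball. [cite: BauerschmidtBrydgesSlade2015Flow, §3.2] -/
theorem mem_scaledBall_iff {b : ℝ} {y : SeqK W × SeqV} : y ∈ scaledBall W b ↔ ‖y.1‖ ≤ b ∧ ‖y.2‖ ≤ b := Iff.rfl

omit [∀ j, NormedSpace ℝ (W j)] in
/-- The ball is closed. [cite: BauerschmidtBrydgesSlade2015Flow, §3.2] -/
theorem isClosed_scaledBall (b : ℝ) : IsClosed (scaledBall W b) :=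
  (isClosed_le (continuous_norm.comp continuous_fst) continuous_const).inter
    (isClosed_le (continuous_norm.comp continuous_snd) continuous_const)

omit [∀ j, NormedSpace ℝ (W j)] in
/-- `0 ∈` ball for `b ≥ 0`. [cite: BauerschmidtBrydgesSlade2015Flow, §3.2] -/
theorem zero_mem_scaledBall {b : ℝ} (hb : 0 ≤ b) : (0 : SeqK W × SeqV) ∈ scaledBall W b := by
  simp [scaledBall, hb]

/-- `physX_j((0,0)) = x̄_j`. [cite: BauerschmidtBrydgesSlade2015Flow, §3.2] -/
@[simp] theorem physX_mk_zero (P : QuadFlowParams) (ψ : ∀ j, W j × V3 → W (j + 1)) (Ω : ℝ) (k : ℕ∞)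
    (g₀ hh aK : ℝ) (K₀ : W 0) (j : ℕ) :
    physX P ψ Ω k g₀ hh aK K₀ j ((0 : W j), (0 : V3)) = baseX P ψ g₀ K₀ j :=
  physX_zero P ψ Ω k g₀ hh aK K₀ j

end ContractionDefs

namespace CutoffQuadHyp

variable {P : QuadFlowParams} {Ω : ℝ} {k : ℕ∞} {B c : ℝ} {N : ℕ} {C lam g₀ : ℝ}
  (h : CutoffQuadHyp P Ω k B c N C lam g₀)
include h

variable {W : ℕ → Type*} [∀ j, NormedAddCommGroup (W j)] [∀ j, NormedSpace ℝ (W j)]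
  {ψ : ∀ j, W j × V3 → W (j + 1)} {ρ : ∀ j, W j × V3 → V3} {a hh κ R M aStar b : ℝ} {K₀ : W 0}

/-- **Standing data of the contraction argument at a base point** `(K₀, g₀)`: `𝗁 > 0`, `b ∈ (0,1]`,
`0 ≤ a_* < a` with `a_* + b(a-a_*) ≤ a`, the conclusion of Lemma 1.3 for `K̄`, and the smallness
`4g₀ ≤ e⁻¹`, `2g₀ ≤ e⁻²`. [cite: BauerschmidtBrydgesSlade2015Flow, Theorem 1.4 (hypotheses) and Lemma 1.3] -/
structure BallHyp (P : QuadFlowParams) (ψ : ∀ j, W j × V3 → W (j + 1)) (Ω : ℝ) (k : ℕ∞) (g₀ hh a aStar b : ℝ)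
    (K₀ : W 0) : Prop where
  /-- `𝗁 > 0`. -/
  hh_pos : 0 < hh
  /-- `b > 0`. -/
  b_pos : 0 < b
  /-- `b ≤ 1`. -/
  b_le : b ≤ 1
  /-- `a_* ≥ 0`. -/
  aStar_nonneg : 0 ≤ aStar
  /-- `a_* < a`. -/
  aStar_lt : aStar < a
  /-- Lemma 1.3: `‖K̄_j‖ ≤ a_*χ_jg̊_j³`. -/
  Kbar_le : ∀ j, ‖Kbar ψ (P.flow g₀) K₀ j‖ ≤ aStar * cutoffWeight Ω k j * gbar P.β g₀ j ^ 3
  /-- `4g₀ ≤ e⁻¹`. -/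
  small1 : 4 * g₀ ≤ Real.exp (-1)
  /-- `2g₀ ≤ e⁻²`. -/
  small2 : 2 * g₀ ≤ Real.exp (-2)

/-- Over the ball every physical point lies in its domain `D_j`. [cite: BauerschmidtBrydgesSlade2015Flow, §3.2] -/
theorem physX_mem_of_ball (hB : BallHyp P ψ Ω k g₀ hh a aStar b K₀) {y : SeqK W × SeqV} (hy : y ∈ scaledBall W b) (j : ℕ) :
    physX P ψ Ω k g₀ hh (a - aStar) K₀ j ((y.1 : ∀ j, W j) j, (y.2 : ℕ → V3) j) ∈
      flowDomain (cutoffWeight Ω k) (P.flow g₀) a hh j := by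
  have hb1 := hB.b_le
  have h1 : ‖(y.1 : ∀ j, W j) j‖ ≤ b := (lp.norm_apply_le_norm ENNReal.top_ne_zero y.1 j).trans hy.1
  have h2 : ‖(y.2 : ℕ → V3) j‖ ≤ b := (lp.norm_apply_le_norm ENNReal.top_ne_zero y.2 j).trans hy.2
  exact h.physX_mem_flowDomain hB.hh_pos.le hb1 (by linarith [hB.aStar_lt])
    (by nlinarith [hB.aStar_lt, hB.b_le, hB.b_pos]) j (hB.Kbar_le j) h1 h2

/-- **`𝒦`-row, sequence level**: for `ỹ, ỹ'` in the ball, `‖(T^K ỹ)_j - (T^K ỹ')_j‖ ≤ κϑ‖K̃ - K̃'‖_∞ +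
(4Mε₁𝗁/(a-a_*))‖Ṽ - Ṽ'‖_∞` for every `j`. [cite: BauerschmidtBrydgesSlade2015Flow, Lemma 3.3, (3.10)] -/
theorem norm_TK_sub_le (hA : HypA3 (cutoffWeight Ω k) ψ ρ (P.flow g₀) a hh κ Ω R M)
    (hB : BallHyp P ψ Ω k g₀ hh a aStar b K₀) {y y' : SeqK W × SeqV} (hy : y ∈ scaledBall W b)
    (hy' : y' ∈ scaledBall W b) (j : ℕ) :
    ‖TK P ψ Ω k g₀ hh (a - aStar) K₀ ((y.1 : ∀ j, W j), (y.2 : ℕ → V3)) j -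
        TK P ψ Ω k g₀ hh (a - aStar) K₀ ((y'.1 : ∀ j, W j), (y'.2 : ℕ → V3)) j‖ ≤
      κ * stepRatio Ω B g₀ * ‖y.1 - y'.1‖ + 4 * M * epsLog g₀ * hh / (a - aStar) * ‖y.2 - y'.2‖ := by
  have haK : 0 < a - aStar := by linarith [hB.aStar_lt]
  have hc1 : 0 ≤ κ * stepRatio Ω B g₀ := mul_nonneg hA.κ_pos.le h.stepRatio_nonneg
  have hc2 : 0 ≤ 4 * M * epsLog g₀ * hh / (a - aStar) := by
    have := hA.M_pos.le; have := h.epsLog_nonneg; have := hB.hh_pos.le; positivity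
  cases j with
  | zero => simp only [TK_zero, sub_self, norm_zero]; positivity
  | succ j =>
    rw [TK_succ, TK_succ]
    refine (h.norm_stepK_sub_le hA hB.small1 hB.hh_pos haK j (h.physX_mem_of_ball hB hy j)
      (h.physX_mem_of_ball hB hy' j)).trans ?_
    have e1 : (y.1 : ∀ j, W j) j - (y'.1 : ∀ j, W j) j = ((y.1 - y'.1 : SeqK W) : ∀ j, W j) j := by
      simp
    have e2 : (y.2 : ℕ → V3) j - (y'.2 : ℕ → V3) j = ((y.2 - y'.2 : SeqV) : ℕ → V3) j := by
      simp
    simp only [e1, e2]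
    gcongr
    · exact lp.norm_apply_le_norm ENNReal.top_ne_zero _ j
    · exact lp.norm_apply_le_norm ENNReal.top_ne_zero _ j

/-- **Scaled source, sequence level**: for `ỹ, ỹ'` in the ball and every `j`,
`‖Ñ_j(ỹ) - Ñ_j(ỹ')‖ ≤ (M(a-a_*)ϑ/𝗁)‖K̃ - K̃'‖_∞ + (8(2B+14C)Ωε₂𝗁b + 4Mε₁)‖Ṽ - Ṽ'‖_∞`.
[cite: BauerschmidtBrydgesSlade2015Flow, Lemma 3.3, (3.10)–(3.11)] -/
theorem norm_srcN_sub_le (hA : HypA3 (cutoffWeight Ω k) ψ ρ (P.flow g₀) a hh κ Ω R M)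
    (hB : BallHyp P ψ Ω k g₀ hh a aStar b K₀) {y y' : SeqK W × SeqV} (hy : y ∈ scaledBall W b)
    (hy' : y' ∈ scaledBall W b) (j : ℕ) :
    ‖srcN P ψ ρ Ω k g₀ hh (a - aStar) K₀ ((y.1 : ∀ j, W j), (y.2 : ℕ → V3)) j -
        srcN P ψ ρ Ω k g₀ hh (a - aStar) K₀ ((y'.1 : ∀ j, W j), (y'.2 : ℕ → V3)) j‖ ≤
      M * (a - aStar) * stepRatio Ω B g₀ / hh * ‖y.1 - y'.1‖ +
        (8 * (2 * B + 14 * C) * Ω * epsLogSq g₀ * hh * b + 4 * M * epsLog g₀) * ‖y.2 - y'.2‖ := by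
  have haK : 0 ≤ a - aStar := by linarith [hB.aStar_lt]
  have hM := hA.M_pos.le; have hε1 := h.epsLog_nonneg; have hε2 := h.epsLogSq_nonneg; have hϑ := h.stepRatio_nonneg
  have hh0 := hB.hh_pos; have hb := hB.b_pos.le
  have hBC : 0 ≤ 2 * B + 14 * C := by have := h.B_nonneg; have := h.C_nonneg; positivity
  have hΩ : 0 ≤ Ω := by linarith [h.one_lt]
  have hc1 : 0 ≤ M * (a - aStar) * stepRatio Ω B g₀ / hh := by positivity
  have hc2 : 0 ≤ 8 * (2 * B + 14 * C) * Ω * epsLogSq g₀ * hh * b + 4 * M * epsLog g₀ := by positivity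
  cases j with
  | zero => simp only [srcN_zero, sub_self, norm_zero]; positivity
  | succ j =>
    rw [srcN_succ, srcN_succ]
    have hyb : ‖(y.2 : ℕ → V3) j‖ ≤ b := (lp.norm_apply_le_norm ENNReal.top_ne_zero y.2 j).trans hy.2
    have hyb' : ‖(y'.2 : ℕ → V3) j‖ ≤ b := (lp.norm_apply_le_norm ENNReal.top_ne_zero y'.2 j).trans hy'.2
    refine (h.norm_stepN_sub_le hA hB.small1 hB.small2 hh0 haK hb j (h.physX_mem_of_ball hB hy j)
      (h.physX_mem_of_ball hB hy' j) hyb hyb').trans ?_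
    have e1 : (y.1 : ∀ j, W j) j - (y'.1 : ∀ j, W j) j = ((y.1 - y'.1 : SeqK W) : ∀ j, W j) j := by
      simp
    have e2 : (y.2 : ℕ → V3) j - (y'.2 : ℕ → V3) j = ((y.2 - y'.2 : SeqV) : ℕ → V3) j := by
      simp
    simp only [e1, e2]
    gcongr
    · exact lp.norm_apply_le_norm ENNReal.top_ne_zero _ j
    · exact lp.norm_apply_le_norm ENNReal.top_ne_zero _ j

omit h in
/-- `T^K(0) = 0` (the base flow is a flow of `Φ̄`). [cite: BauerschmidtBrydgesSlade2015Flow, §3.1, (3.3)] -/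
theorem TK_base (j : ℕ) :
    TK P ψ Ω k g₀ hh (a - aStar) K₀ (((0 : SeqK W × SeqV).1 : ∀ j, W j), ((0 : SeqK W × SeqV).2 : ℕ → V3)) j = 0 := by
  cases j with
  | zero => rfl
  | succ j => simp [TK_succ, physX_mk_zero]

/-- `‖Ñ_j(0)‖ ≤ M/𝗁` ((3.9)). [cite: BauerschmidtBrydgesSlade2015Flow, Lemma 3.3, (3.9)] -/
theorem norm_srcN_base_le (hA : HypA3 (cutoffWeight Ω k) ψ ρ (P.flow g₀) a hh κ Ω R M)
    (hB : BallHyp P ψ Ω k g₀ hh a aStar b K₀) (j : ℕ) :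
    ‖srcN P ψ ρ Ω k g₀ hh (a - aStar) K₀
        (((0 : SeqK W × SeqV).1 : ∀ j, W j), ((0 : SeqK W × SeqV).2 : ℕ → V3)) j‖ ≤ M / hh := by
  have hMh : 0 ≤ M / hh := div_nonneg hA.M_pos.le hB.hh_pos.le
  cases j with
  | zero => simpa using hMh
  | succ j =>
    rw [srcN_succ]
    have hx : baseX P ψ g₀ K₀ j ∈ flowDomain (cutoffWeight Ω k) (P.flow g₀) a hh j :=
      h.baseX_mem_flowDomain hB.hh_pos.le (by linarith [hB.aStar_lt]) j (hB.Kbar_le j)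
    have := h.norm_stepN_zero_le hA hB.hh_pos (aK := a - aStar) (K₀ := K₀) j hx
    simpa [physX_mk_zero] using this

/-- Size of `T^K` on the ball: `‖(T^K ỹ)_j‖ ≤ (κϑ + 4Mε₁𝗁/(a-a_*))·b`. [cite: BauerschmidtBrydgesSlade2015Flow, Lemma 3.3, (3.10)] -/
theorem norm_TK_le (hA : HypA3 (cutoffWeight Ω k) ψ ρ (P.flow g₀) a hh κ Ω R M)
    (hB : BallHyp P ψ Ω k g₀ hh a aStar b K₀) {y : SeqK W × SeqV} (hy : y ∈ scaledBall W b) (j : ℕ) :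
    ‖TK P ψ Ω k g₀ hh (a - aStar) K₀ ((y.1 : ∀ j, W j), (y.2 : ℕ → V3)) j‖ ≤
      (κ * stepRatio Ω B g₀ + 4 * M * epsLog g₀ * hh / (a - aStar)) * b := by
  have := h.norm_TK_sub_le hA hB hy (zero_mem_scaledBall hB.b_pos.le) j
  rw [TK_base, sub_zero] at this
  simp only [Prod.fst_zero, Prod.snd_zero, sub_zero] at this
  have hc1 : 0 ≤ κ * stepRatio Ω B g₀ := mul_nonneg hA.κ_pos.le h.stepRatio_nonneg
  have hc2 : 0 ≤ 4 * M * epsLog g₀ * hh / (a - aStar) := by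
    have := hA.M_pos.le; have := h.epsLog_nonneg; have := hB.hh_pos.le; have : 0 ≤ a - aStar := by linarith [hB.aStar_lt]
    positivity
  calc _ ≤ κ * stepRatio Ω B g₀ * ‖y.1‖ + 4 * M * epsLog g₀ * hh / (a - aStar) * ‖y.2‖ := this
    _ ≤ κ * stepRatio Ω B g₀ * b + 4 * M * epsLog g₀ * hh / (a - aStar) * b := by gcongr <;> [exact hy.1; exact hy.2]
    _ = _ := by ring

/-- Size of `Ñ` on the ball: `‖Ñ_j(ỹ)‖ ≤ M/𝗁 + (M(a-a_*)ϑ/𝗁 + 8(2B+14C)Ωε₂𝗁b + 4Mε₁)·b`.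
[cite: BauerschmidtBrydgesSlade2015Flow, Lemma 3.3, (3.9)–(3.11)] -/
theorem norm_srcN_le (hA : HypA3 (cutoffWeight Ω k) ψ ρ (P.flow g₀) a hh κ Ω R M)
    (hB : BallHyp P ψ Ω k g₀ hh a aStar b K₀) {y : SeqK W × SeqV} (hy : y ∈ scaledBall W b) (j : ℕ) :
    ‖srcN P ψ ρ Ω k g₀ hh (a - aStar) K₀ ((y.1 : ∀ j, W j), (y.2 : ℕ → V3)) j‖ ≤
      M / hh + (M * (a - aStar) * stepRatio Ω B g₀ / hh +
        (8 * (2 * B + 14 * C) * Ω * epsLogSq g₀ * hh * b + 4 * M * epsLog g₀)) * b := by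
  have hd := h.norm_srcN_sub_le hA hB hy (zero_mem_scaledBall hB.b_pos.le) j
  have h0 := h.norm_srcN_base_le hA hB j
  simp only [Prod.fst_zero, Prod.snd_zero, sub_zero] at hd
  have hM := hA.M_pos.le; have hε1 := h.epsLog_nonneg; have hε2 := h.epsLogSq_nonneg; have hϑ := h.stepRatio_nonneg
  have hh0 := hB.hh_pos.le; have hb := hB.b_pos.le; have haK : 0 ≤ a - aStar := by linarith [hB.aStar_lt]
  have hBC : 0 ≤ 2 * B + 14 * C := by have := h.B_nonneg; have := h.C_nonneg; positivity
  have hΩ : 0 ≤ Ω := by linarith [h.one_lt]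
  calc ‖srcN P ψ ρ Ω k g₀ hh (a - aStar) K₀ ((y.1 : ∀ j, W j), (y.2 : ℕ → V3)) j‖
      ≤ ‖srcN P ψ ρ Ω k g₀ hh (a - aStar) K₀ (((0 : SeqK W × SeqV).1 : ∀ j, W j), ((0 : SeqK W × SeqV).2 : ℕ → V3)) j‖ +
        ‖srcN P ψ ρ Ω k g₀ hh (a - aStar) K₀ ((y.1 : ∀ j, W j), (y.2 : ℕ → V3)) j -
          srcN P ψ ρ Ω k g₀ hh (a - aStar) K₀ (((0 : SeqK W × SeqV).1 : ∀ j, W j), ((0 : SeqK W × SeqV).2 : ℕ → V3)) j‖ :=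
        norm_le_insert' _ _
    _ ≤ M / hh + (M * (a - aStar) * stepRatio Ω B g₀ / hh * ‖y.1‖ +
        (8 * (2 * B + 14 * C) * Ω * epsLogSq g₀ * hh * b + 4 * M * epsLog g₀) * ‖y.2‖) := add_le_add h0 hd
    _ ≤ M / hh + (M * (a - aStar) * stepRatio Ω B g₀ / hh * b +
        (8 * (2 * B + 14 * C) * Ω * epsLogSq g₀ * hh * b + 4 * M * epsLog g₀) * b) := by
        gcongr <;> [exact hy.1; exact hy.2]
    _ = _ := by ring

end CutoffQuadHyp


/-! ## The map `T` on the ball: Lipschitz constant, self-mapping, and the fixed point -/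

/-- The Lipschitz constant of the `𝒦`-row of `T`: `κϑ + 4Mε₁𝗁/(a-a_*)`. [cite: BauerschmidtBrydgesSlade2015Flow, Lemma 3.3, (3.10)] -/
def lipK (Ω B g₀ κ M hh aK : ℝ) : ℝ := κ * stepRatio Ω B g₀ + 4 * M * epsLog g₀ * hh / aK

/-- The Lipschitz constant of the scaled source `Ñ`: `M(a-a_*)ϑ/𝗁 + 8(2B+14C)Ωε₂𝗁b + 4Mε₁`.
[cite: BauerschmidtBrydgesSlade2015Flow, Lemma 3.3, (3.10)–(3.11)] -/
def lipN (Ω B C g₀ M hh aK b : ℝ) : ℝ :=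
  M * aK * stepRatio Ω B g₀ / hh + (8 * (2 * B + 14 * C) * Ω * epsLogSq g₀ * hh * b + 4 * M * epsLog g₀)

namespace CutoffQuadHyp

variable {P : QuadFlowParams} {Ω : ℝ} {k : ℕ∞} {B c : ℝ} {N : ℕ} {C lam g₀ : ℝ}
  (h : CutoffQuadHyp P Ω k B c N C lam g₀)
include h

variable {W : ℕ → Type*} [∀ j, NormedAddCommGroup (W j)] [∀ j, NormedSpace ℝ (W j)]
  {ψ : ∀ j, W j × V3 → W (j + 1)} {ρ : ∀ j, W j × V3 → V3} {a hh κ R M aStar b : ℝ} {K₀ : W 0}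

/-- `T^K ỹ ∈ ℓ^∞` on the ball. [cite: BauerschmidtBrydgesSlade2015Flow, Lemma 3.3] -/
theorem memℓp_TK (hA : HypA3 (cutoffWeight Ω k) ψ ρ (P.flow g₀) a hh κ Ω R M)
    (hB : BallHyp P ψ Ω k g₀ hh a aStar b K₀) {y : SeqK W × SeqV} (hy : y ∈ scaledBall W b) :
    Memℓp (TK P ψ Ω k g₀ hh (a - aStar) K₀ ((y.1 : ∀ j, W j), (y.2 : ℕ → V3))) ∞ :=
  memℓp_of_forall_norm_le (h.norm_TK_le hA hB hy)

/-- `Ñ(ỹ) ∈ ℓ^∞` on the ball. [cite: BauerschmidtBrydgesSlade2015Flow, Lemma 3.3] -/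
theorem memℓp_srcN (hA : HypA3 (cutoffWeight Ω k) ψ ρ (P.flow g₀) a hh κ Ω R M)
    (hB : BallHyp P ψ Ω k g₀ hh a aStar b K₀) {y : SeqK W × SeqV} (hy : y ∈ scaledBall W b) :
    Memℓp (srcN P ψ ρ Ω k g₀ hh (a - aStar) K₀ ((y.1 : ∀ j, W j), (y.2 : ℕ → V3))) ∞ :=
  memℓp_of_forall_norm_le (h.norm_srcN_le hA hB hy)

/-- The `𝒦`-component of `Tỹ` on the ball is `T^K ỹ`. [cite: BauerschmidtBrydgesSlade2015Flow, §3.1] -/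
theorem coe_Tmap_fst (hA : HypA3 (cutoffWeight Ω k) ψ ρ (P.flow g₀) a hh κ Ω R M)
    (hB : BallHyp P ψ Ω k g₀ hh a aStar b K₀) (S : SeqV →L[ℝ] SeqV) {y : SeqK W × SeqV} (hy : y ∈ scaledBall W b) :
    ((Tmap P ψ ρ Ω k g₀ hh (a - aStar) K₀ S y).1 : ∀ j, W j) =
      TK P ψ Ω k g₀ hh (a - aStar) K₀ ((y.1 : ∀ j, W j), (y.2 : ℕ → V3)) :=
  coe_toSeqK (h.memℓp_TK hA hB hy)

omit h in
/-- The `𝒱`-component of `Tỹ` is `S` applied to `Ñ(ỹ)`. [cite: BauerschmidtBrydgesSlade2015Flow, §3.1] -/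
theorem Tmap_snd (S : SeqV →L[ℝ] SeqV) (y : SeqK W × SeqV) :
    (Tmap P ψ ρ Ω k g₀ hh (a - aStar) K₀ S y).2 =
      S (toSeqV (srcN P ψ ρ Ω k g₀ hh (a - aStar) K₀ ((y.1 : ∀ j, W j), (y.2 : ℕ → V3)))) := rfl

/-- On the ball the truncation in the `𝒱`-source is the identity. [cite: BauerschmidtBrydgesSlade2015Flow, §3.1] -/
theorem coe_toSeqV_srcN (hA : HypA3 (cutoffWeight Ω k) ψ ρ (P.flow g₀) a hh κ Ω R M)
    (hB : BallHyp P ψ Ω k g₀ hh a aStar b K₀) {y : SeqK W × SeqV} (hy : y ∈ scaledBall W b) :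
    (toSeqV (srcN P ψ ρ Ω k g₀ hh (a - aStar) K₀ ((y.1 : ∀ j, W j), (y.2 : ℕ → V3))) : ℕ → V3) =
      srcN P ψ ρ Ω k g₀ hh (a - aStar) K₀ ((y.1 : ∀ j, W j), (y.2 : ℕ → V3)) :=
  coe_toSeqV (h.memℓp_srcN hA hB hy)

/-- `lipK ≥ 0`. [cite: BauerschmidtBrydgesSlade2015Flow, Lemma 3.3] -/
theorem lipK_nonneg (hA : HypA3 (cutoffWeight Ω k) ψ ρ (P.flow g₀) a hh κ Ω R M)
    (hB : BallHyp P ψ Ω k g₀ hh a aStar b K₀) : 0 ≤ lipK Ω B g₀ κ M hh (a - aStar) := by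
  have := hA.M_pos.le; have := hA.κ_pos.le; have := h.epsLog_nonneg; have := hB.hh_pos.le; have := h.stepRatio_nonneg
  have : 0 ≤ a - aStar := by linarith [hB.aStar_lt]
  unfold lipK; positivity

/-- `lipN ≥ 0`. [cite: BauerschmidtBrydgesSlade2015Flow, Lemma 3.3] -/
theorem lipN_nonneg (hA : HypA3 (cutoffWeight Ω k) ψ ρ (P.flow g₀) a hh κ Ω R M)
    (hB : BallHyp P ψ Ω k g₀ hh a aStar b K₀) : 0 ≤ lipN Ω B C g₀ M hh (a - aStar) b := by
  have := hA.M_pos.le; have := h.epsLog_nonneg; have := h.epsLogSq_nonneg; have := hB.hh_pos.le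
  have := h.stepRatio_nonneg; have := hB.b_pos.le; have : 0 ≤ a - aStar := by linarith [hB.aStar_lt]
  have : 0 ≤ 2 * B + 14 * C := by have := h.B_nonneg; have := h.C_nonneg; positivity
  have : 0 ≤ Ω := by linarith [h.one_lt]
  unfold lipN; positivity

/-- **Lipschitz bound of the `𝒦`-component of `T` on the ball**: `‖(Tỹ)^K - (Tỹ')^K‖_∞ ≤ lipK·‖ỹ - ỹ'‖`.
[cite: BauerschmidtBrydgesSlade2015Flow, Lemma 3.3, (3.10)] -/
theorem norm_Tmap_fst_sub_le (hA : HypA3 (cutoffWeight Ω k) ψ ρ (P.flow g₀) a hh κ Ω R M)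
    (hB : BallHyp P ψ Ω k g₀ hh a aStar b K₀) (S : SeqV →L[ℝ] SeqV) {y y' : SeqK W × SeqV}
    (hy : y ∈ scaledBall W b) (hy' : y' ∈ scaledBall W b) :
    ‖(Tmap P ψ ρ Ω k g₀ hh (a - aStar) K₀ S y).1 - (Tmap P ψ ρ Ω k g₀ hh (a - aStar) K₀ S y').1‖ ≤
      lipK Ω B g₀ κ M hh (a - aStar) * ‖y - y'‖ := by
  have hL := h.lipK_nonneg hA hB
  refine lp.norm_le_of_forall_le (by positivity) fun j => ?_
  rw [lp.coeFn_sub, Pi.sub_apply, h.coe_Tmap_fst hA hB S hy, h.coe_Tmap_fst hA hB S hy']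
  refine (h.norm_TK_sub_le hA hB hy hy' j).trans ?_
  have h1 : ‖y.1 - y'.1‖ ≤ ‖y - y'‖ := by rw [← Prod.fst_sub]; exact norm_fst_le _
  have h2 : ‖y.2 - y'.2‖ ≤ ‖y - y'‖ := by rw [← Prod.snd_sub]; exact norm_snd_le _
  have hc1 : 0 ≤ κ * stepRatio Ω B g₀ := mul_nonneg hA.κ_pos.le h.stepRatio_nonneg
  have hc2 : 0 ≤ 4 * M * epsLog g₀ * hh / (a - aStar) := by
    have := hA.M_pos.le; have := h.epsLog_nonneg; have := hB.hh_pos.le; have : 0 ≤ a - aStar := by linarith [hB.aStar_lt]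
    positivity
  calc κ * stepRatio Ω B g₀ * ‖y.1 - y'.1‖ + 4 * M * epsLog g₀ * hh / (a - aStar) * ‖y.2 - y'.2‖
      ≤ κ * stepRatio Ω B g₀ * ‖y - y'‖ + 4 * M * epsLog g₀ * hh / (a - aStar) * ‖y - y'‖ := by gcongr
    _ = _ := by unfold lipK; ring

/-- **Lipschitz bound of the `𝒱`-component of `T` on the ball**: `‖(Tỹ)^V - (Tỹ')^V‖_∞ ≤ ‖S‖·lipN·‖ỹ - ỹ'‖`.
[cite: BauerschmidtBrydgesSlade2015Flow, Lemma 3.3, (3.10)–(3.11), and Lemma 4.3, (4.12)] -/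
theorem norm_Tmap_snd_sub_le (hA : HypA3 (cutoffWeight Ω k) ψ ρ (P.flow g₀) a hh κ Ω R M)
    (hB : BallHyp P ψ Ω k g₀ hh a aStar b K₀) (S : SeqV →L[ℝ] SeqV) {y y' : SeqK W × SeqV}
    (hy : y ∈ scaledBall W b) (hy' : y' ∈ scaledBall W b) :
    ‖(Tmap P ψ ρ Ω k g₀ hh (a - aStar) K₀ S y).2 - (Tmap P ψ ρ Ω k g₀ hh (a - aStar) K₀ S y').2‖ ≤
      ‖S‖ * lipN Ω B C g₀ M hh (a - aStar) b * ‖y - y'‖ := by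
  have hL := h.lipN_nonneg hA hB
  rw [Tmap_snd, Tmap_snd, ← map_sub]
  refine (S.le_opNorm _).trans ?_
  rw [mul_assoc]
  refine mul_le_mul_of_nonneg_left ?_ (norm_nonneg _)
  refine lp.norm_le_of_forall_le (by positivity) fun j => ?_
  rw [lp.coeFn_sub, Pi.sub_apply, h.coe_toSeqV_srcN hA hB hy, h.coe_toSeqV_srcN hA hB hy']
  refine (h.norm_srcN_sub_le hA hB hy hy' j).trans ?_
  have h1 : ‖y.1 - y'.1‖ ≤ ‖y - y'‖ := by rw [← Prod.fst_sub]; exact norm_fst_le _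
  have h2 : ‖y.2 - y'.2‖ ≤ ‖y - y'‖ := by rw [← Prod.snd_sub]; exact norm_snd_le _
  have hM := hA.M_pos.le; have hε1 := h.epsLog_nonneg; have hε2 := h.epsLogSq_nonneg; have hϑ := h.stepRatio_nonneg
  have hh0 := hB.hh_pos.le; have hb := hB.b_pos.le; have haK : 0 ≤ a - aStar := by linarith [hB.aStar_lt]
  have hBC : 0 ≤ 2 * B + 14 * C := by have := h.B_nonneg; have := h.C_nonneg; positivity
  have hΩ : 0 ≤ Ω := by linarith [h.one_lt]
  calc M * (a - aStar) * stepRatio Ω B g₀ / hh * ‖y.1 - y'.1‖ +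
        (8 * (2 * B + 14 * C) * Ω * epsLogSq g₀ * hh * b + 4 * M * epsLog g₀) * ‖y.2 - y'.2‖
      ≤ M * (a - aStar) * stepRatio Ω B g₀ / hh * ‖y - y'‖ +
        (8 * (2 * B + 14 * C) * Ω * epsLogSq g₀ * hh * b + 4 * M * epsLog g₀) * ‖y - y'‖ := by gcongr
    _ = _ := by unfold lipN; ring

/-- Size of the `𝒦`-component of `Tỹ` on the ball. [cite: BauerschmidtBrydgesSlade2015Flow, Lemma 3.3] -/
theorem norm_Tmap_fst_le (hA : HypA3 (cutoffWeight Ω k) ψ ρ (P.flow g₀) a hh κ Ω R M)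
    (hB : BallHyp P ψ Ω k g₀ hh a aStar b K₀) (S : SeqV →L[ℝ] SeqV) {y : SeqK W × SeqV} (hy : y ∈ scaledBall W b) :
    ‖(Tmap P ψ ρ Ω k g₀ hh (a - aStar) K₀ S y).1‖ ≤ lipK Ω B g₀ κ M hh (a - aStar) * b := by
  have hL := h.lipK_nonneg hA hB
  refine lp.norm_le_of_forall_le (mul_nonneg hL hB.b_pos.le) fun j => ?_
  rw [h.coe_Tmap_fst hA hB S hy]
  exact h.norm_TK_le hA hB hy j

/-- Size of the `𝒱`-component of `Tỹ` on the ball: `‖(Tỹ)^V‖ ≤ ‖S‖(M/𝗁 + lipN·b)`.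
[cite: BauerschmidtBrydgesSlade2015Flow, Lemma 3.3, (3.9)–(3.11)] -/
theorem norm_Tmap_snd_le (hA : HypA3 (cutoffWeight Ω k) ψ ρ (P.flow g₀) a hh κ Ω R M)
    (hB : BallHyp P ψ Ω k g₀ hh a aStar b K₀) (S : SeqV →L[ℝ] SeqV) {y : SeqK W × SeqV} (hy : y ∈ scaledBall W b) :
    ‖(Tmap P ψ ρ Ω k g₀ hh (a - aStar) K₀ S y).2‖ ≤ ‖S‖ * (M / hh + lipN Ω B C g₀ M hh (a - aStar) b * b) := by
  have hL := h.lipN_nonneg hA hB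
  have hMh : 0 ≤ M / hh := div_nonneg hA.M_pos.le hB.hh_pos.le
  rw [Tmap_snd]
  refine (S.le_opNorm _).trans (mul_le_mul_of_nonneg_left ?_ (norm_nonneg _))
  refine lp.norm_le_of_forall_le (by have := hB.b_pos.le; positivity) fun j => ?_
  rw [h.coe_toSeqV_srcN hA hB hy]
  exact (h.norm_srcN_le hA hB hy j).trans (le_of_eq (by unfold lipN; ring))

/-- **The smallness conditions of the contraction** (to be met by `𝗁 ≥ 𝗁_*` and `g₀ ≤ g_*`):
`lipK ≤ θ`, `‖S‖·lipN ≤ θ`, `‖S‖M/𝗁 + θb ≤ b`, `θ < 1`. [cite: BauerschmidtBrydgesSlade2015Flow, Theorem 1.4 ("there exists h_* … there exists g_*")] -/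
structure SmallHyp (Ω B C g₀ κ M hh aK b θ : ℝ) (S : SeqV →L[ℝ] SeqV) : Prop where
  /-- `θ ≥ 0`. -/
  θ_nonneg : 0 ≤ θ
  /-- `θ < 1`. -/
  θ_lt : θ < 1
  /-- The `𝒦`-row contracts. -/
  lipK_le : lipK Ω B g₀ κ M hh aK ≤ θ
  /-- The `𝒱`-rows contract. -/
  lipN_le : ‖S‖ * lipN Ω B C g₀ M hh aK b ≤ θ
  /-- The ball is mapped into itself. -/
  ball_le : ‖S‖ * (M / hh) + θ * b ≤ b

/-- **`T` maps the ball into itself.** [cite: BauerschmidtBrydgesSlade2015Flow, Theorem 1.4(i) (proof, §3.4: "x(t) ∈ x̄ + b𝔹")] -/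
theorem mapsTo_Tmap (hA : HypA3 (cutoffWeight Ω k) ψ ρ (P.flow g₀) a hh κ Ω R M)
    (hB : BallHyp P ψ Ω k g₀ hh a aStar b K₀) {S : SeqV →L[ℝ] SeqV} {θ : ℝ}
    (hS : SmallHyp Ω B C g₀ κ M hh (a - aStar) b θ S) :
    MapsTo (Tmap P ψ ρ Ω k g₀ hh (a - aStar) K₀ S) (scaledBall W b) (scaledBall W b) := by
  intro y hy
  have hb := hB.b_pos.le
  refine ⟨(h.norm_Tmap_fst_le hA hB S hy).trans ?_, (h.norm_Tmap_snd_le hA hB S hy).trans ?_⟩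
  · calc lipK Ω B g₀ κ M hh (a - aStar) * b ≤ θ * b := mul_le_mul_of_nonneg_right hS.lipK_le hb
      _ ≤ 1 * b := mul_le_mul_of_nonneg_right hS.θ_lt.le hb
      _ = b := one_mul b
  · calc ‖S‖ * (M / hh + lipN Ω B C g₀ M hh (a - aStar) b * b)
        = ‖S‖ * (M / hh) + ‖S‖ * lipN Ω B C g₀ M hh (a - aStar) b * b := by ring
      _ ≤ ‖S‖ * (M / hh) + θ * b := by gcongr; exact hS.lipN_le
      _ ≤ b := hS.ball_le

/-- **`T` is `θ`-Lipschitz on the ball.** [cite: BauerschmidtBrydgesSlade2015Flow, Lemma 3.3 and Lemma 3.5 (the role of ‖S‖)] -/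
theorem lipschitzOnWith_Tmap (hA : HypA3 (cutoffWeight Ω k) ψ ρ (P.flow g₀) a hh κ Ω R M)
    (hB : BallHyp P ψ Ω k g₀ hh a aStar b K₀) {S : SeqV →L[ℝ] SeqV} {θ : ℝ}
    (hS : SmallHyp Ω B C g₀ κ M hh (a - aStar) b θ S) :
    LipschitzOnWith (Real.toNNReal θ) (Tmap P ψ ρ Ω k g₀ hh (a - aStar) K₀ S) (scaledBall W b) := by
  refine LipschitzOnWith.of_dist_le_mul fun y hy y' hy' => ?_
  rw [dist_eq_norm, dist_eq_norm, Real.coe_toNNReal _ hS.θ_nonneg, Prod.norm_def]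
  refine max_le ?_ ?_
  · rw [Prod.fst_sub]
    exact (h.norm_Tmap_fst_sub_le hA hB S hy hy').trans (mul_le_mul_of_nonneg_right hS.lipK_le (norm_nonneg _))
  · rw [Prod.snd_sub]
    exact (h.norm_Tmap_snd_sub_le hA hB S hy hy').trans (mul_le_mul_of_nonneg_right hS.lipN_le (norm_nonneg _))

/-- **Existence of the fixed point of `T` in the ball** (Banach's fixed point theorem on the closed
ball of the Banach space `ℓ^∞(∏𝒲_j) × ℓ^∞(ℝ³)`); it replaces the time-1 map of the ODE (3.4) of the
source. [cite: BauerschmidtBrydgesSlade2015Flow, Theorem 1.4(i) (proof, §3.1 and §3.4)] -/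
theorem exists_fixedPoint_Tmap [∀ j, CompleteSpace (W j)] (hA : HypA3 (cutoffWeight Ω k) ψ ρ (P.flow g₀) a hh κ Ω R M)
    (hB : BallHyp P ψ Ω k g₀ hh a aStar b K₀) {S : SeqV →L[ℝ] SeqV} {θ : ℝ}
    (hS : SmallHyp Ω B C g₀ κ M hh (a - aStar) b θ S) :
    ∃ y ∈ scaledBall W b, Tmap P ψ ρ Ω k g₀ hh (a - aStar) K₀ S y = y := by
  have hmaps := h.mapsTo_Tmap hA hB hS
  have hlip := h.lipschitzOnWith_Tmap hA hB hS
  have hc : ContractingWith (Real.toNNReal θ) (hmaps.restrict _ _ _) :=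
    ⟨by simpa using hS.θ_lt, hlip.mapsToRestrict hmaps⟩
  obtain ⟨y, hy, hfix, -⟩ := ContractingWith.exists_fixedPoint' (isClosed_scaledBall b).isComplete hmaps hc
    (zero_mem_scaledBall hB.b_pos.le) (edist_ne_top _ _)
  exact ⟨y, hy, hfix⟩

/-- **Uniqueness of the fixed point in the ball.** [cite: BauerschmidtBrydgesSlade2015Flow, Theorem 1.4(i) (uniqueness clause)] -/
theorem fixedPoint_unique (hA : HypA3 (cutoffWeight Ω k) ψ ρ (P.flow g₀) a hh κ Ω R M)
    (hB : BallHyp P ψ Ω k g₀ hh a aStar b K₀) {S : SeqV →L[ℝ] SeqV} {θ : ℝ}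
    (hS : SmallHyp Ω B C g₀ κ M hh (a - aStar) b θ S) {y y' : SeqK W × SeqV}
    (hy : y ∈ scaledBall W b) (hy' : y' ∈ scaledBall W b)
    (hfy : Tmap P ψ ρ Ω k g₀ hh (a - aStar) K₀ S y = y) (hfy' : Tmap P ψ ρ Ω k g₀ hh (a - aStar) K₀ S y' = y') :
    y = y' := by
  have hlip := (h.lipschitzOnWith_Tmap hA hB hS).dist_le_mul y hy y' hy'
  rw [hfy, hfy', Real.coe_toNNReal _ hS.θ_nonneg] at hlip
  have hd : dist y y' = 0 := by
    have := dist_nonneg (x := y) (y := y')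
    nlinarith [hS.θ_lt]
  exact dist_eq_zero.1 hd

end CutoffQuadHyp


/-! ## From the fixed point to the flow: Theorem 1.4(i) (existence and the bounds (1.11)–(1.14)) at
an admissible initial condition -/

section FlowDefs

variable {W : ℕ → Type*}

/-- "`x = (K_j, V_j)_j` is a global flow of `Φ = (ψ, φ̄ + ρ)`": `K_{j+1} = ψ_j(K_j, V_j)`,
`V_{j+1} = φ̄_j(V_j) + ρ_j(K_j, V_j)` for all `j` ((1.4)–(1.5)). [cite: BauerschmidtBrydgesSlade2015Flow, §1.1, (1.4)–(1.5)] -/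
def IsPerturbedFlow (P : QuadFlowParams) (ψ : ∀ j, W j × V3 → W (j + 1)) (ρ : ∀ j, W j × V3 → V3)
    (x : ∀ j, W j × V3) : Prop :=
  ∀ j, x (j + 1) = (ψ j (x j), P.map j (x j).2 + ρ j (x j))

variable [∀ j, NormedAddCommGroup (W j)]

/-- The bounds (1.11)–(1.14) of Theorem 1.4 for `x = (K_j, g_j, z_j, μ_j)_j` against the flow
`x̄ = (K̄, V̄)` of `Φ̄` with the same boundary conditions: `‖K_j - K̄_j‖ ≤ b(a - a_*)χ_jḡ_j³`,
`|g_j - ḡ_j| ≤ bhḡ_j²|log ḡ_j|`, `|z_j - z̄_j| ≤ bhχ_jḡ_j²|log ḡ_j|`, `|μ_j - μ̄_j| ≤ bhχ_jḡ_j²|log ḡ_j|`.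
[cite: BauerschmidtBrydgesSlade2015Flow, Theorem 1.4, (1.11)–(1.14)] [cite: BauerschmidtBrydgesSlade2015LogCorr, Theorem 7.2.1(i)] -/
def FlowBounds (χ : ℕ → ℝ) (ψ : ∀ j, W j × V3 → W (j + 1)) (Vb : ℕ → V3) (K₀ : W 0) (a aStar hh b : ℝ)
    (x : ∀ j, W j × V3) : Prop :=
  ∀ j, ‖(x j).1 - Kbar ψ Vb K₀ j‖ ≤ b * (a - aStar) * χ j * Vb j 0 ^ 3 ∧
    |(x j).2 0 - Vb j 0| ≤ b * hh * Vb j 0 ^ 2 * |Real.log (Vb j 0)| ∧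
    |(x j).2 1 - Vb j 1| ≤ b * hh * χ j * Vb j 0 ^ 2 * |Real.log (Vb j 0)| ∧
    |(x j).2 2 - Vb j 2| ≤ b * hh * χ j * Vb j 0 ^ 2 * |Real.log (Vb j 0)|

variable [∀ j, NormedSpace ℝ (W j)]

/-- The physical sequence `x_j = x̄_j + (𝗐_K K̃_j, 𝗐_V·Ṽ_j)` of a scaled point `ỹ`. [cite: BauerschmidtBrydgesSlade2015Flow, §3.2] -/
def physSeq (P : QuadFlowParams) (ψ : ∀ j, W j × V3 → W (j + 1)) (Ω : ℝ) (k : ℕ∞) (g₀ hh aK : ℝ) (K₀ : W 0)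
    (y : SeqK W × SeqV) (j : ℕ) : W j × V3 :=
  physX P ψ Ω k g₀ hh aK K₀ j ((y.1 : ∀ j, W j) j, (y.2 : ℕ → V3) j)

end FlowDefs

namespace CutoffQuadHyp

variable {P : QuadFlowParams} {Ω : ℝ} {k : ℕ∞} {B c : ℝ} {N : ℕ} {C lam g₀ : ℝ}
  (h : CutoffQuadHyp P Ω k B c N C lam g₀)
include h

variable {W : ℕ → Type*} [∀ j, NormedAddCommGroup (W j)] [∀ j, NormedSpace ℝ (W j)]
  {ψ : ∀ j, W j × V3 → W (j + 1)} {ρ : ∀ j, W j × V3 → V3} {a hh κ R M aStar b : ℝ} {K₀ : W 0}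

/-- **The `𝒦`-row of a fixed point is the `𝒦`-flow equation**: `K_{j+1} = ψ_j(x_j)`, and `K₀` is the
prescribed initial condition. [cite: BauerschmidtBrydgesSlade2015Flow, Theorem 1.4(i) (proof) and (1.4)] -/
theorem physSeq_K_of_fixedPoint (hA : HypA3 (cutoffWeight Ω k) ψ ρ (P.flow g₀) a hh κ Ω R M)
    (hB : BallHyp P ψ Ω k g₀ hh a aStar b K₀) (S : SeqV →L[ℝ] SeqV) {y : SeqK W × SeqV} (hy : y ∈ scaledBall W b)
    (hfix : Tmap P ψ ρ Ω k g₀ hh (a - aStar) K₀ S y = y) :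
    (physSeq P ψ Ω k g₀ hh (a - aStar) K₀ y 0).1 = K₀ ∧
      ∀ j, (physSeq P ψ Ω k g₀ hh (a - aStar) K₀ y (j + 1)).1 = ψ j (physSeq P ψ Ω k g₀ hh (a - aStar) K₀ y j) := by
  have hK := h.coe_Tmap_fst hA hB S hy
  rw [hfix] at hK
  have haK : 0 < a - aStar := by linarith [hB.aStar_lt]
  constructor
  · have hK0 : (y.1 : ∀ j, W j) 0 = 0 := by have := congrFun hK 0; rwa [TK_zero] at this
    simp only [physSeq, physX, Kbar_zero]
    rw [hK0, smul_zero, add_zero]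
  · intro j
    have hw : P.wK g₀ Ω k (a - aStar) (j + 1) ≠ 0 := (h.wK_pos haK (j + 1)).ne'
    have hKj : (y.1 : ∀ j, W j) (j + 1) = (P.wK g₀ Ω k (a - aStar) (j + 1))⁻¹ •
        (ψ j (physX P ψ Ω k g₀ hh (a - aStar) K₀ j ((y.1 : ∀ j, W j) j, (y.2 : ℕ → V3) j)) -
          ψ j (baseX P ψ g₀ K₀ j)) := by
      have := congrFun hK (j + 1); rwa [TK_succ] at this
    show (physX P ψ Ω k g₀ hh (a - aStar) K₀ (j + 1) ((y.1 : ∀ j, W j) (j + 1), (y.2 : ℕ → V3) (j + 1))).1 =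
      ψ j (physX P ψ Ω k g₀ hh (a - aStar) K₀ j ((y.1 : ∀ j, W j) j, (y.2 : ℕ → V3) j))
    simp only [physX, Kbar_succ]
    rw [hKj, smul_inv_smul₀ hw]
    simp only [baseX, physX]
    abel

/-- **The `𝒱`-rows of a fixed point are the `𝒱`-flow equations** `V_{j+1} = φ̄_j(V_j) + ρ_j(x_j)`, with
`g₀` prescribed and `(z_j, μ_j) → (0, 0)`; here `S = S̄_{𝒱𝒱}`. [cite: BauerschmidtBrydgesSlade2015Flow, Theorem 1.4(i) (proof) and (1.5)] -/
theorem physSeq_V_of_fixedPoint (hA : HypA3 (cutoffWeight Ω k) ψ ρ (P.flow g₀) a hh κ Ω R M)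
    (hB : BallHyp P ψ Ω k g₀ hh a aStar b K₀) {y : SeqK W × SeqV} (hy : y ∈ scaledBall W b)
    (hfix : Tmap P ψ ρ Ω k g₀ hh (a - aStar) K₀ (h.sbarVP hB.small1 hB.hh_pos) y = y) :
    (physSeq P ψ Ω k g₀ hh (a - aStar) K₀ y 0).2 0 = g₀ ∧
      (∀ j, (physSeq P ψ Ω k g₀ hh (a - aStar) K₀ y (j + 1)).2 =
        P.map j (physSeq P ψ Ω k g₀ hh (a - aStar) K₀ y j).2 + ρ j (physSeq P ψ Ω k g₀ hh (a - aStar) K₀ y j)) ∧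
      Tendsto (fun j => (physSeq P ψ Ω k g₀ hh (a - aStar) K₀ y j).2 1) atTop (𝓝 0) ∧
      Tendsto (fun j => (physSeq P ψ Ω k g₀ hh (a - aStar) K₀ y j).2 2) atTop (𝓝 0) := by
  set S := h.sbarVP hB.small1 hB.hh_pos with hS
  set r : SeqV := toSeqV (srcN P ψ ρ Ω k g₀ hh (a - aStar) K₀ ((y.1 : ∀ j, W j), (y.2 : ℕ → V3))) with hr_def
  have hr : (r : ℕ → V3) = srcN P ψ ρ Ω k g₀ hh (a - aStar) K₀ ((y.1 : ∀ j, W j), (y.2 : ℕ → V3)) :=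
    h.coe_toSeqV_srcN hA hB hy
  have hV : y.2 = S r := by
    have := Tmap_snd (P := P) (ψ := ψ) (ρ := ρ) (Ω := Ω) (k := k) (g₀ := g₀) (hh := hh) (a := a) (aStar := aStar) (K₀ := K₀) S y
    rw [hfix] at this; exact this
  obtain ⟨⟨h0, hg, hz, hμ⟩, tz, tμ⟩ := h.sbarVP_solves hB.small1 hB.hh_pos r
  rw [← hV] at h0 hg hz hμ tz tμ
  have hv : ∀ j, P.vV g₀ Ω k hh (j + 1) ≠ 0 := fun j => (h.vV_pos hB.hh_pos (j + 1)).ne'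
  -- the physical source at position `j+1`
  have hsrc : ∀ j (i : Fin 3), P.vV g₀ Ω k hh (j + 1) * (r : ℕ → V3) (j + 1) i =
      (P.quadRem j (P.flow g₀ j) (physV P Ω k g₀ hh j ((y.2 : ℕ → V3) j)) +
        ρ j (physSeq P ψ Ω k g₀ hh (a - aStar) K₀ y j)) i := by
    intro j i
    rw [hr, srcN_succ, Pi.smul_apply, smul_eq_mul, ← mul_assoc, mul_inv_cancel₀ (hv j), one_mul]
    rfl
  have hG0 : P.wG g₀ hh 0 ≠ 0 := (h.wG_pos hB.hh_pos 0).ne'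
  refine ⟨?_, fun j => ?_, ?_, ?_⟩
  · -- `g₀`: `G₀ = 𝗐_{g,0}ỹ_{g,0} = 0`
    simp only [physSeq, physX, Pi.add_apply, physV_apply_zero, QuadFlowParams.flow_apply_zero, gbar_zero]
    have : P.wG g₀ hh 0 * (y.2 : ℕ → V3) 0 0 = 0 := h0
    rw [this, add_zero]
  · -- the `𝒱`-equation at step `j`
    have hflow : P.flow g₀ (j + 1) = P.map j (P.flow g₀ j) := (h.isQuadFlowBC_flow).1 j
    set u : V3 := physV P Ω k g₀ hh j ((y.2 : ℕ → V3) j) with hu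
    have hstep : physV P Ω k g₀ hh (j + 1) ((y.2 : ℕ → V3) (j + 1)) =
        P.dmap j (P.flow g₀ j) u + (P.quadRem j (P.flow g₀ j) u + ρ j (physSeq P ψ Ω k g₀ hh (a - aStar) K₀ y j)) := by
      obtain ⟨d0, d1, d2⟩ := P.dmap_flow_apply j g₀ u
      ext i
      fin_cases i
      · simp only [Fin.zero_eta, Fin.isValue, physV_apply_zero, Pi.add_apply, d0]
        rw [hg j, hsrc j 0]; simp [hu]
      · simp only [Fin.mk_one, Fin.isValue, physV_apply_one, Pi.add_apply, d1]
        rw [hz j, hsrc j 1]; simp [hu]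
      · simp only [Fin.reduceFinMk, Fin.isValue, physV_apply_two, Pi.add_apply, d2]
        rw [hμ j, hsrc j 2]; simp [hu]
    show P.flow g₀ (j + 1) + physV P Ω k g₀ hh (j + 1) ((y.2 : ℕ → V3) (j + 1)) =
      P.map j (P.flow g₀ j + u) + ρ j (physSeq P ψ Ω k g₀ hh (a - aStar) K₀ y j)
    rw [hstep, hflow]
    simp only [QuadFlowParams.quadRem]
    abel
  · -- `z_j = z̄_j + Z_j → 0`
    have := h.tendsto_zbar_zero.add tz
    rw [add_zero] at this
    refine this.congr fun j => ?_
    simp [physSeq, physX]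
  · have := h.tendsto_mubar_zero.add tμ
    rw [add_zero] at this
    refine this.congr fun j => ?_
    simp [physSeq, physX]

/-- **The bounds (1.11)–(1.14) and the domain condition for the physical sequence of a point of the
ball.** [cite: BauerschmidtBrydgesSlade2015Flow, Theorem 1.4, (1.11)–(1.14) and §3.2] -/
theorem flowBounds_physSeq (hB : BallHyp P ψ Ω k g₀ hh a aStar b K₀) {y : SeqK W × SeqV} (hy : y ∈ scaledBall W b) :
    FlowBounds (cutoffWeight Ω k) ψ (P.flow g₀) K₀ a aStar hh b (physSeq P ψ Ω k g₀ hh (a - aStar) K₀ y) ∧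
      ∀ j, physSeq P ψ Ω k g₀ hh (a - aStar) K₀ y j ∈ flowDomain (cutoffWeight Ω k) (P.flow g₀) a hh j := by
  refine ⟨fun j => ?_, fun j => h.physX_mem_of_ball hB hy j⟩
  have haK : 0 ≤ a - aStar := by linarith [hB.aStar_lt]
  have hh0 := hB.hh_pos.le
  have h1 : ‖(y.1 : ∀ j, W j) j‖ ≤ b := (lp.norm_apply_le_norm ENNReal.top_ne_zero y.1 j).trans hy.1
  have h2 : ∀ i, |(y.2 : ℕ → V3) j i| ≤ b := fun i =>
    ((QuadFlowParams.abs_apply_le_norm _ i).trans (lp.norm_apply_le_norm ENNReal.top_ne_zero y.2 j)).trans hy.2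
  have hw := (h.weight_pos j).le; have hg := (h.gbar_pos j).le
  have hK0 : 0 ≤ P.wK g₀ Ω k (a - aStar) j := by unfold QuadFlowParams.wK; positivity
  have hG0 : 0 ≤ P.wG g₀ hh j := by unfold QuadFlowParams.wG; positivity
  have hZ0 : 0 ≤ P.wZ g₀ Ω k hh j := by unfold QuadFlowParams.wZ; positivity
  simp only [physSeq, physX, add_sub_cancel_left, Pi.add_apply, physV_apply_zero, physV_apply_one, physV_apply_two,
    QuadFlowParams.flow_apply_zero]
  refine ⟨?_, ?_, ?_, ?_⟩
  · rw [norm_smul, Real.norm_eq_abs, abs_of_nonneg hK0, QuadFlowParams.wK]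
    calc (a - aStar) * (cutoffWeight Ω k j * gbar P.β g₀ j ^ 3) * ‖(y.1 : ∀ j, W j) j‖
        ≤ (a - aStar) * (cutoffWeight Ω k j * gbar P.β g₀ j ^ 3) * b := by gcongr
      _ = _ := by ring
  · rw [abs_mul, abs_of_nonneg hG0, QuadFlowParams.wG]
    calc hh * (gbar P.β g₀ j ^ 2 * |Real.log (gbar P.β g₀ j)|) * |(y.2 : ℕ → V3) j 0|
        ≤ hh * (gbar P.β g₀ j ^ 2 * |Real.log (gbar P.β g₀ j)|) * b := by gcongr; exact h2 0
      _ = _ := by ring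
  · rw [abs_mul, abs_of_nonneg hZ0, QuadFlowParams.wZ]
    calc hh * (cutoffWeight Ω k j * gbar P.β g₀ j ^ 2 * |Real.log (gbar P.β g₀ j)|) * |(y.2 : ℕ → V3) j 1|
        ≤ hh * (cutoffWeight Ω k j * gbar P.β g₀ j ^ 2 * |Real.log (gbar P.β g₀ j)|) * b := by gcongr; exact h2 1
      _ = _ := by ring
  · rw [abs_mul, abs_of_nonneg hZ0, QuadFlowParams.wZ]
    calc hh * (cutoffWeight Ω k j * gbar P.β g₀ j ^ 2 * |Real.log (gbar P.β g₀ j)|) * |(y.2 : ℕ → V3) j 2|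
        ≤ hh * (cutoffWeight Ω k j * gbar P.β g₀ j ^ 2 * |Real.log (gbar P.β g₀ j)|) * b := by gcongr; exact h2 2
      _ = _ := by ring

/-- **[BBS-rg-flow, Theorem 1.4(i), existence part, at an admissible initial condition]** in the
conditional form of this file: under (A1)–(A2) packaged as `CutoffQuadHyp` at `g₀`, (A3) along the base
flow, the ball data (`BallHyp`: `𝗁 > 0`, `b ∈ (0,1]`, `a_* < a`, Lemma 1.3) and the smallness
`SmallHyp` for `S = S̄_{𝒱𝒱}` (met by `𝗁 ≥ 𝗁_*`, `g₀ ≤ g_*`), there is a global flow `x` of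
`Φ = (ψ, φ̄ + ρ)` in `∏_j D_j` with `K₀`, `g₀` prescribed and `(z_∞, μ_∞) = (0, 0)` obeying the bounds
(1.11)–(1.14) against `x̄ = (K̄, V̄)`. [cite: BauerschmidtBrydgesSlade2015Flow, Theorem 1.4(i)]
[cite: BauerschmidtBrydgesSlade2015LogCorr, Theorem 7.2.1(i)] -/
theorem exists_perturbedFlow [∀ j, CompleteSpace (W j)] (hA : HypA3 (cutoffWeight Ω k) ψ ρ (P.flow g₀) a hh κ Ω R M)
    (hB : BallHyp P ψ Ω k g₀ hh a aStar b K₀) {θ : ℝ}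
    (hS : SmallHyp Ω B C g₀ κ M hh (a - aStar) b θ (h.sbarVP hB.small1 hB.hh_pos)) :
    ∃ x : ∀ j, W j × V3,
      (∀ j, x j ∈ flowDomain (cutoffWeight Ω k) (P.flow g₀) a hh j) ∧
      IsPerturbedFlow P ψ ρ x ∧ (x 0).1 = K₀ ∧ (x 0).2 0 = g₀ ∧
      Tendsto (fun j => (x j).2 1) atTop (𝓝 0) ∧ Tendsto (fun j => (x j).2 2) atTop (𝓝 0) ∧
      FlowBounds (cutoffWeight Ω k) ψ (P.flow g₀) K₀ a aStar hh b x := by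
  obtain ⟨y, hy, hfix⟩ := h.exists_fixedPoint_Tmap hA hB hS
  obtain ⟨hK0, hK⟩ := h.physSeq_K_of_fixedPoint hA hB _ hy hfix
  obtain ⟨hg0, hV, tz, tμ⟩ := h.physSeq_V_of_fixedPoint hA hB hy hfix
  obtain ⟨hbd, hdom⟩ := h.flowBounds_physSeq hB hy
  refine ⟨physSeq P ψ Ω k g₀ hh (a - aStar) K₀ y, hdom, fun j => ?_, hK0, hg0, tz, tμ, hbd⟩
  exact Prod.ext (hK j) (hV j)

end CutoffQuadHyp


end CTWSAW

end Literature.Barriers.CriticalPhenomena
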